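import Mathlib.AlgebraicGeometry.PullbackCarrier
import Mathlib.AlgebraicGeometry.Morphisms.SurjectiveOnStalks
import HarnessLib

/-!
# Residue fields of points of a fibre product

Topic: `Literature/AlgebraicGeometry/Resolution`. Generic scheme theory serving de Jong 1996, 4.16
("Constructing `(X', Z')` as in 4.15, we see that `Z' = Z'₁ ∪ … ∪ Z'ₙ` with `Z'ᵢ → Y'` finite and
birational"): the residue field `κ(p)` of a point `p` of `X ×_S Y` over `x ∈ X` and `y ∈ Y` is a
compositum of `κ(x)` and `κ(y)` over `κ(s)` (Stacks 01JT; EGA I 3.4.9), used in the form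

* `Scheme.Pullback.residueFieldMap_snd_surjective_of_range_subset` — **if the image of
  `κ(x) → κ(p)` lies in the image of `κ(y) → κ(p)`, then `κ(y) → κ(p)` is an isomorphism**
  (surjective). Proof by the universal properties only: `κ(x) → κ(p)` factors through `κ(y)`, so
  the point `Spec κ(p) → X ×_S Y` factors through a `κ(y)`-valued point with the same image `p`,
  which by the classification of field-valued points (Mathlib `Scheme.SpecToEquivOfField`)
  splits `κ(y) → κ(p)`;
* `Scheme.Hom.residueFieldMap_surjective` — morphisms surjective on stalks (closed immersions,
  preimmersions) are surjective on residue fields.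

## Sources

* The Stacks Project, Tag 01JT (points of fibre products and their residue fields).
* A. Grothendieck, J. Dieudonné, EGA I (1971), 3.4.9.
-/

noncomputable section

open CategoryTheory CategoryTheory.Limits AlgebraicGeometry

namespace Literature.AlgebraicGeometry.Resolution

universe u

/-- A morphism which is surjective on stalks (e.g. a closed immersion) is surjective on residue
fields: `κ(f x) → κ(x)` is onto. [folklore] -/
theorem Scheme.Hom.residueFieldMap_surjective {X Y : Scheme.{u}} (f : X ⟶ Y)
    [SurjectiveOnStalks f] (x : X) : Function.Surjective (f.residueFieldMap x) := by
  intro c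
  obtain ⟨s, rfl⟩ := X.residue_surjective x c
  obtain ⟨t, rfl⟩ := f.stalkMap_surjective x s
  refine ⟨Y.residue (f x) t, ?_⟩
  change (Y.residue (f x) ≫ f.residueFieldMap x) t = (f.stalkMap x ≫ X.residue x) t
  rw [Scheme.residue_residueFieldMap]

/-- Two ring maps out of the residue field `κ(p)` which induce the same morphism
`Spec K → X` through `Spec κ(p) → X` are equal (Mathlib's classification
`Scheme.SpecToEquivOfField` of the `K`-valued points of `X`). [folklore] -/
theorem Scheme.eq_of_SpecMap_comp_fromSpecResidueField_eq {X : Scheme.{u}} {K : Type u} [Field K]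
    {p : X} {φ₁ φ₂ : X.residueField p ⟶ .of K}
    (h : Spec.map φ₁ ≫ X.fromSpecResidueField p = Spec.map φ₂ ≫ X.fromSpecResidueField p) :
    φ₁ = φ₂ := by
  have h' : (Scheme.SpecToEquivOfField K X).symm ⟨p, φ₁⟩ =
      (Scheme.SpecToEquivOfField K X).symm ⟨p, φ₂⟩ := h
  obtain ⟨e, he⟩ := Scheme.SpecToEquivOfField_eq_iff.mp ((Equiv.injective _) h')
  simpa using he

/-- **The residue field of a point of a fibre product is a compositum** (Stacks 01JT), in the
form: let `p ∈ X ×_S Y` lie over `x ∈ X` and `y ∈ Y`; if the image of `κ(x) → κ(p)` is contained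
in the image of `κ(y) → κ(p)`, then `κ(y) → κ(p)` is surjective (an isomorphism of fields).
Indeed `κ(x) → κ(p)` then factors as `κ(x) → κ(y) → κ(p)` compatibly with `κ(s)`, so
`Spec κ(y)` maps to `X ×_S Y` with image `p` and `Spec κ(p) → X ×_S Y` factors through it; the
corresponding ring map `κ(p) → κ(y)` is a section of `κ(y) → κ(p)`.
[cite: StacksProject, Tag 01JT] -/
theorem Scheme.Pullback.residueFieldMap_snd_surjective_of_range_subset {X Y S : Scheme.{u}}
    (f : X ⟶ S) (g : Y ⟶ S) (p : ↥(pullback f g))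
    (h : Set.range ((pullback.fst f g).residueFieldMap p) ⊆
      Set.range ((pullback.snd f g).residueFieldMap p)) :
    Function.Surjective ((pullback.snd f g).residueFieldMap p) := by
  -- notation: `a : κ(x) → κ(p)`, `r : κ(y) → κ(p)`
  set x := pullback.fst f g p with hx
  set y := pullback.snd f g p with hy
  set a := (pullback.fst f g).residueFieldMap p with ha
  set r := (pullback.snd f g).residueFieldMap p with hr
  let K : Type u := ↥(Y.residueField y)
  have hrinj : Function.Injective r := r.hom.injective
  haveI : Mono r := ConcreteCategory.mono_of_injective r hrinj
  -- `a` factors through `r`: `a = a' ≫ r`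
  let e : K ≃+* r.hom.range :=
    RingEquiv.ofBijective r.hom.rangeRestrict
      ⟨fun s t hst => hrinj (congrArg Subtype.val hst), r.hom.rangeRestrict_surjective⟩
  let a' : X.residueField x ⟶ CommRingCat.of K :=
    CommRingCat.ofHom (e.symm.toRingHom.comp (a.hom.codRestrict r.hom.range fun t => h ⟨t, rfl⟩))
  have ha' : a' ≫ r = a := by
    ext t
    change ((e (e.symm ⟨a t, h ⟨t, rfl⟩⟩) : r.hom.range) : ↥((pullback f g).residueField p)) = a t
    rw [RingEquiv.apply_symm_apply]
  -- compatibility with `κ(s)`, `s = f x = g y`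
  have e₀ : g y = f x := (Scheme.Pullback.Triplet.ofPoint p).hy
  have key : ((S.residueFieldCongr (rfl : f x = f x)).inv ≫ f.residueFieldMap x) ≫ a =
      ((S.residueFieldCongr e₀).inv ≫ g.residueFieldMap y) ≫ r :=
    Scheme.Pullback.residueFieldCongr_inv_residueFieldMap_ofPoint p
  have hcomp : f.residueFieldMap x ≫ a' = (S.residueFieldCongr e₀).inv ≫ g.residueFieldMap y := by
    rw [← cancel_mono r, Category.assoc, ha', ← key]
    simp only [Scheme.residueFieldCongr_refl, Iso.refl_inv, Category.id_comp]
  -- the `κ(y)`-valued point of `X ×_S Y` through which `Spec κ(p)` factors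
  let u₁ : Spec (CommRingCat.of K) ⟶ X := Spec.map a' ≫ X.fromSpecResidueField x
  let u₂ : Spec (CommRingCat.of K) ⟶ Y := Y.fromSpecResidueField y
  have hu : u₁ ≫ f = u₂ ≫ g := by
    have e1 : u₁ ≫ f = Spec.map (f.residueFieldMap x ≫ a') ≫ S.fromSpecResidueField (f x) := by
      simp only [u₁, Category.assoc, Spec.map_comp]
      rw [← Scheme.Hom.SpecMap_residueFieldMap_fromSpecResidueField f x]
    rw [e1, hcomp, Spec.map_comp, Category.assoc, Scheme.residueFieldCongr_inv,
      Scheme.residueFieldCongr_fromSpecResidueField]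
    exact Scheme.Hom.SpecMap_residueFieldMap_fromSpecResidueField g y
  let u : Spec (CommRingCat.of K) ⟶ pullback f g := pullback.lift u₁ u₂ hu
  have hru : Spec.map r ≫ u = (pullback f g).fromSpecResidueField p := by
    apply pullback.hom_ext
    · rw [Category.assoc, pullback.lift_fst]
      change Spec.map r ≫ Spec.map a' ≫ X.fromSpecResidueField x = _
      rw [← Spec.map_comp_assoc, ha']
      exact Scheme.Hom.SpecMap_residueFieldMap_fromSpecResidueField (pullback.fst f g) p
    · rw [Category.assoc, pullback.lift_snd]
      exact Scheme.Hom.SpecMap_residueFieldMap_fromSpecResidueField (pullback.snd f g) p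
  -- `u` has image `p`
  have hup : u (IsLocalRing.closedPoint K) = p := by
    have h1 : Spec.map r (IsLocalRing.closedPoint ((pullback f g).residueField p)) =
        IsLocalRing.closedPoint K := Subsingleton.elim _ _
    rw [← h1, ← Scheme.Hom.comp_apply, hru, Scheme.fromSpecResidueField_apply]
  -- so `u = Spec.map φ ≫ (Spec κ(p) → X ×_S Y)` for a ring map `φ : κ(p) → κ(y)`
  obtain ⟨φ, hφ⟩ : ∃ φ : (pullback f g).residueField p ⟶ CommRingCat.of K,
      Spec.map φ ≫ (pullback f g).fromSpecResidueField p = u := by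
    set s := Scheme.SpecToEquivOfField K (pullback f g) u with hs
    have hq : s.1 = p := hup
    refine ⟨((pullback f g).residueFieldCongr hq).inv ≫ s.2, ?_⟩
    have h2 : (Scheme.SpecToEquivOfField K (pullback f g)).symm s = u := Equiv.symm_apply_apply _ _
    rw [Scheme.SpecToEquivOfField_symm_apply] at h2
    rw [Spec.map_comp, Category.assoc, Scheme.residueFieldCongr_inv,
      Scheme.residueFieldCongr_fromSpecResidueField]
    exact h2
  -- `φ` is a section of `r`
  have hsec : φ ≫ r = 𝟙 _ := by
    have h3 : Spec.map (φ ≫ r) ≫ (pullback f g).fromSpecResidueField p =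
        Spec.map (𝟙 _) ≫ (pullback f g).fromSpecResidueField p := by
      rw [Spec.map_comp, Category.assoc, hφ, hru, Spec.map_id, Category.id_comp]
    exact Scheme.eq_of_SpecMap_comp_fromSpecResidueField_eq h3
  intro t
  exact ⟨φ t, by rw [← CommRingCat.comp_apply, hsec]; rfl⟩

end Literature.AlgebraicGeometry.Resolution

end
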